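import Literature.Analysis.FluidPDE.BoundedL2ClassicalMild
import Literature.Analysis.FluidPDE.OseenMildHolder
import Literature.Analysis.FluidPDE.ClassicalSolutionRescale
import Summits.NavierStokesRegularity.NavierStokesRegularity.Theorems.GaldiLiouvilleGateRecordZoomAncientStubZoomLimit
import HarnessLib

/-!
# Route FrozenSignCascade · crux `BoundedEnvelopeContinuation` (stmt-NavierStokesRegularity-10579)
# line `registered`, reshape r3 — stub `stub_nearFinalPersistence` (the record zooms do not
# collapse at the space origin shortly before the final time)

**Statement.** Let `(u, p)` be a classical solution of the unforced Navier–Stokes system with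
viscosity `ν > 0` on `ℝ³ × [0, T)`, Leray–Hopf from `u 0`. Let base times `tc n > 0`, centres
`xc n`, levels `Λ n = ‖u (tc n) (xc n)‖ > 0` and slacks `e n > 0` satisfy `tc n + e n < T`,
`‖u‖ ≤ 2 Λ n` on `[0, tc n + e n] × ℝ³` and `tc n (Λ n)² → ∞`. Then for the sup-normalised
viscosity-normalising zooms `z n s y = (Λ n)⁻¹ u(tc n + ν s/(Λ n)², xc n + (ν/Λ n) y)` there is ONE
negative time `s⋆ < 0` with `‖z n s⋆ 0‖ ≥ 1/2` for all large `n`.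

**Proof (KNSS 2009, §6 with Lemma 4.1 / Prop. 4.1).** Each zoom is a classical solution with
viscosity `1` (`IsClassicalNSSolutionOn.stRescale`, scales `α = Λ⁻¹`, `γ = ν/Λ`, `β = α γ`) on the
window `(A n, b n)`, `A n = -tc n (Λ n)²/ν`, `b n = e n (Λ n)²/ν > 0`; on `(A n, b n]` it is
bounded by `2` and has `L²`-bounded slices (Leray–Hopf energy bound
`IsLerayHopfOn.lintegral_enorm_sq_le` and the change of variables
`RecordZoomAncient.Birth.eLpNorm_comp_space_affine`), so it satisfies the Oseen identity
`z n t = e^{(t-s)Δ} z n s − B¹ₛ(z n, z n)(t)` for `A n < s < t < b n / 2`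
(`mild_of_bounded_of_eLpNorm_two_le_of_lt`), in particular for `A n < s < t ≤ 0`. Since
`tc n (Λ n)² → ∞`, eventually `A n < -2`, and the uniform `1/4`-Hölder modulus of bounded
Oseen-mild fields one unit of time after the start of the window
(`exists_holder_quarter_of_oseenMild`, window `[-2, 0]`, bound `m = 2`) gives
`‖z n 0 0 − z n s 0‖ ≤ K₀ (2 + 2²) |s|^{1/4}` for `s ∈ [-1, 0]`, with a universal `K₀`. As
`‖z n 0 0‖ = Λ⁻¹ ‖u (tc n) (xc n)‖ = 1`, the choice `s⋆ = -δ⁴`, `δ = min (1/2) (12 K₀)⁻¹`, yields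
`‖z n s⋆ 0‖ ≥ 1 − 6 K₀ δ ≥ 1/2`.

Sources: G. Koch, N. Nadirashvili, G. Seregin, V. Šverák, Acta Math. 203 (2009) = arXiv:0709.3599,
§6 (the limit of the record zooms is nonzero: `|v(0,0)| = 1` by the uniform local regularity),
Lemma 4.1 and Prop. 4.1 (p. 8).
-/

noncomputable section

open Set MeasureTheory Filter Topology Metric Function
open scoped ENNReal NNReal
open Literature.Analysis Literature.Analysis.FluidPDE

namespace Summit.NavierStokesRegularity.NavierStokesRegularity.Theorems.BoundedEnvelope

-- the problem-side namespace duplicates `NavierStokesRegularity` by design (D-0017)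
set_option linter.dupNamespace false

/-- **stub Z2c — `stub_nearFinalPersistence` (KNSS 2009, §6: the record zooms stay `≥ 1/2` in
norm at the space origin at one fixed negative time, for all large `n`).** Statement and proof in
the module docstring: the zoom has norm `1` at the space–time origin, is bounded by `2` and
Oseen-mild on its window, and bounded Oseen-mild fields have a uniform `1/4`-Hölder modulus one
unit of time after the start of the window.
[cite: KochNadirashviliSereginSverak2009, Prop. 4.1 (arXiv:0709.3599)] -/
theorem stub_nearFinalPersistence :
    ∀ (ν T : ℝ), 0 < ν → 0 < T →
      ∀ (u : ℝ → EuclideanSpace ℝ (Fin 3) → EuclideanSpace ℝ (Fin 3))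
        (p : ℝ → EuclideanSpace ℝ (Fin 3) → ℝ),
        IsClassicalNSSolutionOn (Set.Ico 0 T) ν 0 u p → IsLerayHopfOn T ν 0 (u 0) u →
        ∀ (tc : ℕ → ℝ) (xc : ℕ → EuclideanSpace ℝ (Fin 3)) (Λ e : ℕ → ℝ),
          (∀ n, 0 < tc n) → (∀ n, 0 < e n) → (∀ n, tc n + e n < T) → (∀ n, 0 < Λ n) →
          (∀ n, Λ n = ‖u (tc n) (xc n)‖) →
          (∀ n, ∀ s ∈ Set.Icc 0 (tc n + e n), ∀ x, ‖u s x‖ ≤ 2 * Λ n) →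
          Tendsto (fun n => tc n * Λ n ^ 2) atTop atTop →
          ∀ z : ℕ → ℝ → EuclideanSpace ℝ (Fin 3) → EuclideanSpace ℝ (Fin 3),
            (∀ n s y, z n s y = (Λ n)⁻¹ • u (tc n + ν / Λ n ^ 2 * s) (xc n + (ν / Λ n) • y)) →
            ∃ s : ℝ, s < 0 ∧ ∀ᶠ n in atTop, (1 / 2 : ℝ) ≤ ‖z n s 0‖ := by
  intro ν T hν hT u p hcl hLH tc xc Λ e htc he hte hΛ hΛeq hdom hprod z hz
  -- ### scales `α = Λ⁻¹`, `γ = ν/Λ`, `β = α γ = ν/Λ²` (viscosity `α ν/γ = 1`), windows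
  have hαpos : ∀ n, 0 < (Λ n)⁻¹ := fun n => inv_pos.2 (hΛ n)
  have hγpos : ∀ n, 0 < ν / Λ n := fun n => div_pos hν (hΛ n)
  have hβpos : ∀ n, 0 < ν / Λ n ^ 2 := fun n => div_pos hν (pow_pos (hΛ n) 2)
  obtain ⟨A, hA⟩ : ∃ A : ℕ → ℝ, ∀ n, A n = -(tc n * Λ n ^ 2 / ν) := ⟨_, fun n => rfl⟩
  obtain ⟨b, hb⟩ : ∃ b : ℕ → ℝ, ∀ n, b n = e n * Λ n ^ 2 / ν := ⟨_, fun n => rfl⟩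
  have halg : ∀ n s, ν / Λ n ^ 2 = (Λ n)⁻¹ * (ν / Λ n) ∧ (Λ n)⁻¹ * ν / (ν / Λ n) = 1 ∧
      tc n + ν / Λ n ^ 2 * s = ν / Λ n ^ 2 * (s - A n) ∧
      tc n + e n - (tc n + ν / Λ n ^ 2 * s) = ν / Λ n ^ 2 * (b n - s) ∧
      (Λ n)⁻¹ * (2 * Λ n) = 2 := by
    intro n s
    have hΛn : Λ n ≠ 0 := (hΛ n).ne'
    have hν0 : ν ≠ 0 := hν.ne'
    rw [hA n, hb n]
    refine ⟨?_, ?_, ?_, ?_, ?_⟩ <;> field_simp <;> ring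
  have hbpos : ∀ n, 0 < b n := fun n =>
    (hb n).symm ▸ div_pos (mul_pos (he n) (pow_pos (hΛ n) 2)) hν
  -- original times of rescaled times
  have hmem_Icc : ∀ n s, A n < s → s ≤ b n →
      tc n + ν / Λ n ^ 2 * s ∈ Icc 0 (tc n + e n) := by
    intro n s h1 h2
    obtain ⟨-, -, hoA, hob, -⟩ := halg n s
    have h3 : 0 ≤ ν / Λ n ^ 2 * (s - A n) := mul_nonneg (hβpos n).le (by linarith)
    have h4 : 0 ≤ ν / Λ n ^ 2 * (b n - s) := mul_nonneg (hβpos n).le (by linarith)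
    constructor <;> linarith
  have hmem_Ico : ∀ n s, A n < s → s < b n → tc n + ν / Λ n ^ 2 * s ∈ Ico 0 T := by
    intro n s h1 h2
    have h := hmem_Icc n s h1 h2.le
    exact ⟨h.1, h.2.trans_lt (hte n)⟩
  -- ### the zooms are classical solutions with viscosity `1` on `(A n, b n)`
  have hzslice : ∀ n s, z n s =
      (Λ n)⁻¹ • fun y => u (tc n + ν / Λ n ^ 2 * s) (xc n + (ν / Λ n) • y) :=
    fun n s => funext fun y => hz n s y
  have hzeq : ∀ n, z n = (Λ n)⁻¹ • stPull (ν / Λ n ^ 2) (ν / Λ n) (tc n) (xc n) u :=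
    fun n => funext fun s => funext fun y => by rw [hz n s y]; rfl
  have hclz : ∀ n, IsClassicalNSSolutionOn (Ioo (A n) (b n)) 1 0 (z n)
      ((Λ n)⁻¹ ^ 2 • stPull (ν / Λ n ^ 2) (ν / Λ n) (tc n) (xc n) p) := by
    intro n
    obtain ⟨hβeq, hvisc, -⟩ := halg n 0
    have h := hcl.stRescale (hαpos n) (hγpos n) hβeq (tc n) (xc n)
    rw [smul_stPull_zero, hvisc, ← hzeq n] at h
    exact h.mono (fun s hs => hmem_Ico n s hs.1 hs.2) (uniqueDiffOn_Ioo _ _)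
  -- the bound `2` of the zooms on `(A n, b n]` and the value `1` of their norm at the origin
  have hzb : ∀ n s, A n < s → s ≤ b n → ∀ y, ‖z n s y‖ ≤ 2 := by
    intro n s h1 h2 y
    obtain ⟨-, -, -, -, h2Λ⟩ := halg n s
    rw [hz n s y, norm_smul, Real.norm_of_nonneg (hαpos n).le, ← h2Λ]
    exact mul_le_mul_of_nonneg_left (hdom n _ (hmem_Icc n s h1 h2) _) (hαpos n).le
  have hz0 : ∀ n, ‖z n 0 0‖ = 1 := by
    intro n
    rw [hz n 0 0, mul_zero, add_zero, smul_zero, add_zero, norm_smul,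
      Real.norm_of_nonneg (hαpos n).le, ← hΛeq n, inv_mul_cancel₀ (hΛ n).ne']
  -- `L²` bounds of the zoom slices (Leray–Hopf energy bound and change of variables)
  obtain ⟨E2, hE2top, hE2⟩ : ∃ E2 : ℝ≥0∞, E2 ≠ ∞ ∧ ∀ t ∈ Icc 0 T, eLpNorm (u t) 2 volume ≤ E2 := by
    refine ⟨ENNReal.ofReal (Real.sqrt (2 * VectorCalculus.kineticEnergy (u 0))),
      ENNReal.ofReal_ne_top, fun t ht => (ENNReal.pow_le_pow_left_iff two_ne_zero).1 ?_⟩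
    rw [eLpNorm_two_sq_eq_lintegral, ← ENNReal.ofReal_pow (Real.sqrt_nonneg _),
      Real.sq_sqrt (mul_nonneg zero_le_two (kineticEnergy_nonneg _))]
    exact hLH.lintegral_enorm_sq_le hν.le ht
  have hKz : ∀ n, ∃ K : ℝ≥0∞, K ≠ ∞ ∧ ∀ s, A n < s → s ≤ b n → eLpNorm (z n s) 2 volume ≤ K := by
    intro n
    refine ⟨‖(Λ n)⁻¹‖ₑ *
      (ENNReal.ofReal ((ν / Λ n) ^ Module.finrank ℝ (EuclideanSpace ℝ (Fin 3)))⁻¹ ^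
        (1 / (2 : ℝ≥0∞)).toReal * E2), ?_, fun s h1 h2 => ?_⟩
    · exact ENNReal.mul_ne_top enorm_ne_top (ENNReal.mul_ne_top
        (ENNReal.rpow_ne_top_of_nonneg ENNReal.toReal_nonneg ENNReal.ofReal_ne_top) hE2top)
    · rw [hzslice n s, eLpNorm_const_smul,
        RecordZoomAncient.Birth.eLpNorm_comp_space_affine (hγpos n) (xc n) _ 2]
      gcongr
      have h := hmem_Icc n s h1 h2
      exact hE2 _ ⟨h.1, h.2.trans (hte n).le⟩
  -- ### the Oseen identity of each zoom for `A n < s < t ≤ 0` (through the window `(A n, b n / 2)`)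
  have hmildz : ∀ n, ∀ s t : ℝ, A n < s → s < t → t ≤ 0 → ∀ x,
      z n t x = UnboundedOperators.heatExtension (z n s) (t - s) x -
        oseenDuhamel 1 s (z n) (z n) t x := by
    intro n s t h1 h2 h3 x
    obtain ⟨K, hKtop, hK⟩ := hKz n
    have hb2 : 0 < b n / 2 := half_pos (hbpos n)
    have hb2le : b n / 2 ≤ b n := half_le_self (hbpos n).le
    exact mild_of_bounded_of_eLpNorm_two_le_of_lt (hclz n)
      (h1.trans (h2.trans_le (h3.trans hb2.le))) (half_lt_self (hbpos n))
      (fun τ hτ y => hzb n τ hτ.1 (hτ.2.trans hb2le) y) hKtop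
      (fun τ hτ => hK τ hτ.1 (hτ.2.trans hb2le)) h1 h2 (h3.trans_lt hb2) x
  -- ### the uniform Hölder modulus and the choice of the negative time
  obtain ⟨K₀, hK₀, hmod⟩ := exists_holder_quarter_of_oseenMild (E := EuclideanSpace ℝ (Fin 3))
  set δ : ℝ := min (1 / 2) (12 * K₀)⁻¹ with hδ
  have hδpos : 0 < δ := lt_min (by norm_num) (inv_pos.2 (by positivity))
  have hδle : δ ≤ 1 / 2 := min_le_left _ _
  have hδK : δ ≤ (12 * K₀)⁻¹ := min_le_right _ _
  have hδ4pos : 0 < δ ^ 4 := pow_pos hδpos 4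
  have hδ4le : δ ^ 4 ≤ 1 := pow_le_one₀ hδpos.le (hδle.trans (by norm_num))
  have h6 : K₀ * (2 + 2 ^ 2) * δ ≤ 1 / 2 := by
    calc K₀ * (2 + 2 ^ 2) * δ ≤ K₀ * (2 + 2 ^ 2) * (12 * K₀)⁻¹ := by gcongr
      _ = 1 / 2 := by field_simp; norm_num
  refine ⟨-δ ^ 4, neg_neg_of_pos hδ4pos, ?_⟩
  -- eventually the window `(A n, b n)` contains `[-2, 0]`
  filter_upwards [hprod.eventually_gt_atTop (2 * ν)] with n hn
  have hAn : A n < -2 := by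
    rw [hA n, neg_lt_neg_iff, lt_div_iff₀ hν]
    exact hn
  -- the modulus on the window `[-2, 0]` with the bound `m = 2`
  have hcont : ∀ t ∈ Icc (-2 : ℝ) 0, Continuous (z n t) := fun t ht =>
    ((hclz n).contDiff_velocity ⟨hAn.trans_le ht.1, ht.2.trans_lt (hbpos n)⟩).continuous
  have hbd2 : ∀ t ∈ Icc (-2 : ℝ) 0, ∀ x, ‖z n t x‖ ≤ 2 := fun t ht x =>
    hzb n t (hAn.trans_le ht.1) (ht.2.trans (hbpos n).le) x
  have hmild2 : ∀ s t : ℝ, -2 ≤ s → s < t → t ≤ 0 → ∀ x,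
      z n t x = UnboundedOperators.heatExtension (z n s) (t - s) x -
        oseenDuhamel 1 s (z n) (z n) t x :=
    fun s t h1 h2 h3 x => hmildz n s t (hAn.trans_le h1) h2 h3 x
  have hH : ‖z n 0 0 - z n (-δ ^ 4) 0‖ ≤ K₀ * (2 + 2 ^ 2) * δ := by
    have h := hmod zero_le_two hcont hbd2 hmild2 (-δ ^ 4) ⟨by linarith, by linarith⟩ 0
      ⟨by norm_num, le_rfl⟩ 0 0
    have hmax : (max |(0 : ℝ) - -δ ^ 4| ‖(0 : EuclideanSpace ℝ (Fin 3)) - 0‖) ^ (1 / 4 : ℝ) = δ := by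
      rw [sub_zero, norm_zero, sub_neg_eq_add, zero_add, abs_of_pos hδ4pos,
        max_eq_left hδ4pos.le, show (1 / 4 : ℝ) = ((4 : ℕ) : ℝ)⁻¹ by norm_num,
        Real.pow_rpow_inv_natCast hδpos.le four_ne_zero]
    rwa [hmax] at h
  have hns : ‖z n 0 0‖ - ‖z n (-δ ^ 4) 0‖ ≤ ‖z n 0 0 - z n (-δ ^ 4) 0‖ := norm_sub_norm_le _ _
  rw [hz0 n] at hns
  linarith

end Summit.NavierStokesRegularity.NavierStokesRegularity.Theorems.BoundedEnvelope

end
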